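import Mathlib
import HarnessLib
import Summits.NavierStokesRegularity.NavierStokesRegularity.Theorems.PoloidalWindowDoorLrcModEntireShearedScalarCalculus
import Summits.NavierStokesRegularity.NavierStokesRegularity.Theorems.PoloidalWindowDoorLrcModEntireVerticalDifferenceLaw
import Summits.NavierStokesRegularity.NavierStokesRegularity.Theorems.PoloidalWindowDoorLrcModEntireQ4SonicHotSheetJet

/-!
# Route `PoloidalWindowDoor`, item `LrcModEntire` (stmt-NavierStokesRegularity-20428), cell (Q4-sonic, straight branch), case I, PERIODIC branch —
# THE DIFFERENCE ROW (E3_D) IN SHEARED COORDINATES = `hR3` for `(ϑ, P_D, Q_D)` (P2b-ii of the LEAD picks; T2B-g17 v10 §9/§10)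

Cell ns-regularity-ideate, LEAD-lineage seat ns-poloidal-K2-p3 g17 (`--supports stmt-NavierStokesRegularity-20428`).

The analogue of ns-k2-port-2 g8's `…ShearedVerticalRow.verticalRow_sheared` (p742995) for the DIFFERENCE of a class profile and its horizontal translate:
with `F(t,y) := U₂(t, y+a) − U₂(t,y)`, `P_D(t,y) := ⟪e, U(t,y+a) − U(t,y)⟫`, `Q_D(t,y) := ⟪Je, U(t,y+a) − U(t,y)⟫` (lambdas, no definitions) and the moving shear `Φ`
of `…ShearedCoordinates`, at every tube point `p` (`Φp = (t,x)`, `z = x₂`):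
`(1−μ)·[ (∂_t′ − d_t∂_m)(F∘Φ) + Uᵃ_e ∂_s(F∘Φ) + Uᵃ_ν ∂_m(F∘Φ) + θᵃ (∂_z′ − d_z∂_m)(F∘Φ) − (1−μ)(∂_m² + ∂_s²)(F∘Φ) + (P_D∘Φ)·θ_e + (Q_D∘Φ)·θ_ν + (F∘Φ)·θ_z ]`
`= (μ_t − μ_zz)·(F∘Φ) + (μ_z/2)(θᵃ + θ)·(F∘Φ) − 2μ_z·(∂_z′ − d_z∂_m)(F∘Φ)`
(`Uᵃ = U(t,x+a)`, `θ = U₂(t,x)`, `θᵃ = U₂(t,x+a)`, `θ_e, θ_ν, θ_z` the slice derivatives of `U₂(t,·)` at `x`; transport by the TRANSLATED field, coupling through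
the background gradient `∇θ(x)`).  Ingredients: `…VerticalDifferenceLaw.verticalDifference_law` (p745221), `convect_difference_split`, the chain rules of
`…ShearedCoordinates`, `…ShearedScalarCalculus` (time derivative and horizontal Laplacian of a general scalar), `frame_decomp`.
This is `hR3` of `…SheetSystemMixed.eq_zero_of_mixedSystem_template` for the difference system (before dividing by `(1−μ)²`); `hR1/hR2` = LEAD p745853
`…ShearedKinematicsField`; data = ns-poloidal-K2-p2 g17 `cauchyData_periodic_of_package`; END = LEAD p744193 `false_of_difference_eq_zero_on_tube`.

WHAT THIS IS NOT: not a claim about Navier–Stokes regularity and not a stub of the registry; class-level bookkeeping for the residual research cell `stub_Q4sonicLineNeg`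
of `Cruxes/LrcModEntire/Lines/twist_split.lean` v13 (bears_on LADDER-NS N0 via item 20428).
-/

noncomputable section

set_option linter.dupNamespace false
set_option linter.style.longLine false

namespace Summit.NavierStokesRegularity.NavierStokesRegularity.Theorems.PoloidalWindowDoorLrcModEntireShearedDifferenceRow

open Set Function Filter Topology Metric InnerProductSpace
open scoped RealInnerProductSpace InnerProductSpace Laplacian ContDiff
open Literature.Analysis Literature.Analysis.FluidPDE
open Summit.NavierStokesRegularity.NavierStokesRegularity.Theorems.PoloidalWindowDoorPoloidalWindowRigidityWindow
open Summit.NavierStokesRegularity.NavierStokesRegularity.Theorems.PoloidalWindowDoorPoloidalWindowRigiditySlopeFunctionPressure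
open Summit.NavierStokesRegularity.NavierStokesRegularity.Theorems.PoloidalWindowDoorLrcModEntireSheetFlattenTools
open Summit.NavierStokesRegularity.NavierStokesRegularity.Theorems.PoloidalWindowDoorLrcModEntireSheetSystemUniqueness
open Summit.NavierStokesRegularity.NavierStokesRegularity.Theorems.PoloidalWindowDoorLrcModEntireShearedCoordinates
open Summit.NavierStokesRegularity.NavierStokesRegularity.Theorems.PoloidalWindowDoorLrcModEntireShearedKinematics
open Summit.NavierStokesRegularity.NavierStokesRegularity.Theorems.PoloidalWindowDoorLrcModEntireShearedSecondOrder
open Summit.NavierStokesRegularity.NavierStokesRegularity.Theorems.PoloidalWindowDoorLrcModEntireShearedScalarCalculus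
open Summit.NavierStokesRegularity.NavierStokesRegularity.Theorems.PoloidalWindowDoorLrcModEntireVerticalDifferenceLaw
open Summit.NavierStokesRegularity.NavierStokesRegularity.Theorems.PoloidalWindowDoorLrcModEntireQ4SonicHotSheetJet

variable {C : ℝ} {U : ℝ → E3 → E3} {μ : ℝ → ℝ → ℝ} {ρ : ℝ} {e a : E3} {O : Set Y3} {D : Set (ℝ × ℝ)} {d : ℝ × ℝ → ℝ}

/-- The difference scalar `F(t,y) = U₂(t,y+a) − U₂(t,y)` is smooth on `(−∞,0) × ℝ³` for a class profile. -/
theorem contDiffOn_difference (hA : IsTypeIAncientMild C U) (a : E3) :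
    ContDiffOn ℝ ∞ (fun q : ℝ × E3 => U q.1 (q.2 + a) 2 - U q.1 q.2 2) (Iio (0 : ℝ) ×ˢ (univ : Set E3)) := by
  have hW : ContDiffOn ℝ ∞ (uncurry U) (Iio (0 : ℝ) ×ˢ (univ : Set E3)) := hA.contDiffOn
  have hshift : ContDiffOn ℝ ∞ (fun q : ℝ × E3 => uncurry U (q.1, q.2 + a)) (Iio (0 : ℝ) ×ˢ (univ : Set E3)) := by
    refine hW.comp ((contDiff_fst.prodMk (contDiff_snd.add contDiff_const)).contDiffOn) ?_
    intro q hq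
    exact mem_prod.2 ⟨(mem_prod.1 hq).1, mem_univ _⟩
  have h2 : ContDiffOn ℝ ∞ (fun q : ℝ × E3 => uncurry U (q.1, q.2 + a) 2 - uncurry U q 2) (Iio (0 : ℝ) ×ˢ (univ : Set E3)) :=
    ((EuclideanSpace.proj (𝕜 := ℝ) (2 : Fin 3)).contDiff.comp_contDiffOn hshift).sub
      ((EuclideanSpace.proj (𝕜 := ℝ) (2 : Fin 3)).contDiff.comp_contDiffOn hW)
  exact h2

/-- ★★ **THE DIFFERENCE ROW (E3_D) IN SHEARED COORDINATES.**  See the module docstring. -/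
theorem differenceRow_sheared
    (hrate : FluidPDE.HasTypeITimeDecay C U) (hcont : ContinuousOn (uncurry U) (Iio (0 : ℝ) ×ˢ univ))
    (hmild : ∀ s t : ℝ, s < t → t < 0 → ∀ x, U t x = UnboundedOperators.heatExtension (U s) (t - s) x - FluidPDE.oseenDuhamel 1 s U U t x)
    (hdiv : ∀ t < 0, FluidPDE.VectorCalculus.IsDivFree (U t))
    (hpol : ∀ s < 0, ∀ y, ⟪FluidPDE.curl (U s) y, EuclideanSpace.single 2 1⟫_ℝ = 0)
    (hμ3 : ContDiff ℝ 3 (uncurry μ))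
    (hslabU : ∀ t : ℝ, |t + 1| < ρ → ∀ x : E3, |x 2| < ρ → ∀ b : Fin 3, b ≠ 2 →
      fderiv ℝ (U t) x (EuclideanSpace.single 2 1) b = μ t (x 2) * fderiv ℝ (U t) x (EuclideanSpace.single b 1) 2)
    (he2 : e 2 = 0) (hunit : e 0 ^ 2 + e 1 ^ 2 = 1) (ha : a 2 = 0)
    (hO : IsOpen O) (hOt : ∀ y ∈ O, y.1 < 0 ∧ |y.1 + 1| < ρ ∧ |y.2.2| < ρ)
    (hD : IsOpen D) (hd : ContDiffOn ℝ ∞ d D) (hOD : ∀ y ∈ O, (y.1, y.2.2) ∈ D) {p : Y3 × ℝ} (hp : p ∈ tube O) :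
    (1 - μ p.1.1 p.1.2.2) *
        ((pd (tg eT) ((fun q : ℝ × E3 => U q.1 (q.2 + a) 2 - U q.1 q.2 2) ∘ shearMap e d) p
            - fderiv ℝ d (p.1.1, p.1.2.2) ((1 : ℝ), (0 : ℝ)) * pd dN ((fun q : ℝ × E3 => U q.1 (q.2 + a) 2 - U q.1 q.2 2) ∘ shearMap e d) p)
          + ((U p.1.1 (shearPt e d p + a) 0 * e 0 + U p.1.1 (shearPt e d p + a) 1 * e 1) *
                pd (tg eS) ((fun q : ℝ × E3 => U q.1 (q.2 + a) 2 - U q.1 q.2 2) ∘ shearMap e d) p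
              + (U p.1.1 (shearPt e d p + a) 1 * e 0 - U p.1.1 (shearPt e d p + a) 0 * e 1) *
                pd dN ((fun q : ℝ × E3 => U q.1 (q.2 + a) 2 - U q.1 q.2 2) ∘ shearMap e d) p
              + U p.1.1 (shearPt e d p + a) 2 *
                (pd (tg PoloidalWindowDoorLrcModEntireShearedCoordinates.eZ) ((fun q : ℝ × E3 => U q.1 (q.2 + a) 2 - U q.1 q.2 2) ∘ shearMap e d) p
                  - fderiv ℝ d (p.1.1, p.1.2.2) ((0 : ℝ), (1 : ℝ)) * pd dN ((fun q : ℝ × E3 => U q.1 (q.2 + a) 2 - U q.1 q.2 2) ∘ shearMap e d) p))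
          - (1 - μ p.1.1 p.1.2.2) *
              (pd dN (pd dN ((fun q : ℝ × E3 => U q.1 (q.2 + a) 2 - U q.1 q.2 2) ∘ shearMap e d)) p
                + pd (tg eS) (pd (tg eS) ((fun q : ℝ × E3 => U q.1 (q.2 + a) 2 - U q.1 q.2 2) ∘ shearMap e d)) p)
          + (((fun q : ℝ × E3 => ⟪e, U q.1 (q.2 + a) - U q.1 q.2⟫_ℝ) ∘ shearMap e d) p * fderiv ℝ (fun y : E3 => U p.1.1 y 2) (shearPt e d p) e
              + ((fun q : ℝ × E3 => ⟪Jvec e, U q.1 (q.2 + a) - U q.1 q.2⟫_ℝ) ∘ shearMap e d) p * fderiv ℝ (fun y : E3 => U p.1.1 y 2) (shearPt e d p) (Jvec e)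
              + ((fun q : ℝ × E3 => U q.1 (q.2 + a) 2 - U q.1 q.2 2) ∘ shearMap e d) p * fderiv ℝ (fun y : E3 => U p.1.1 y 2) (shearPt e d p) e2)) =
      (deriv (fun s => μ s p.1.2.2) p.1.1 - deriv (deriv (μ p.1.1)) p.1.2.2) *
          ((fun q : ℝ × E3 => U q.1 (q.2 + a) 2 - U q.1 q.2 2) ∘ shearMap e d) p
        + deriv (μ p.1.1) p.1.2.2 / 2 * (U p.1.1 (shearPt e d p + a) 2 + U p.1.1 (shearPt e d p) 2) *
          ((fun q : ℝ × E3 => U q.1 (q.2 + a) 2 - U q.1 q.2 2) ∘ shearMap e d) p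
        - 2 * deriv (μ p.1.1) p.1.2.2 *
          (pd (tg PoloidalWindowDoorLrcModEntireShearedCoordinates.eZ) ((fun q : ℝ × E3 => U q.1 (q.2 + a) 2 - U q.1 q.2 2) ∘ shearMap e d) p
            - fderiv ℝ d (p.1.1, p.1.2.2) ((0 : ℝ), (1 : ℝ)) * pd dN ((fun q : ℝ × E3 => U q.1 (q.2 + a) 2 - U q.1 q.2 2) ∘ shearMap e d) p) := by
  set F : ℝ × E3 → ℝ := fun q => U q.1 (q.2 + a) 2 - U q.1 q.2 2 with hF_def
  set G : Y3 × ℝ → ℝ := F ∘ shearMap e d with hG_def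
  set t : ℝ := p.1.1 with ht_def
  set x : E3 := shearPt e d p with hx_def
  set z : ℝ := p.1.2.2 with hz_def
  obtain ⟨ht0, htρ, hzρ⟩ := hOt p.1 hp
  have hdp : DifferentiableAt ℝ d (t, z) := (hd.contDiffAt (hD.mem_nhds (hOD p.1 hp))).differentiableAt (by simp)
  have hx2 : x 2 = z := by
    rw [hx_def, hz_def]; simp [shearPt, Jvec, e2, he2]
  have hxρ : |x 2| < ρ := by rw [hx2]; exact hzρ
  -- smoothness
  set T : Set ℝ := Iio 0 with hT_def
  have hT : IsOpen T := isOpen_Iio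
  have hA := isTypeIAncientMild_of_class hrate hcont hmild hdiv
  have hF : ContDiffOn ℝ ∞ F (T ×ˢ (univ : Set E3)) := contDiffOn_difference hA a
  have hOT : ∀ y ∈ O, y.1 ∈ T := fun y hy => (hOt y hy).1
  have htT : t ∈ T := ht0
  obtain ⟨hFd, -, -⟩ := differentiableAt_data (F := F) hT hF hOT hD hd hOD hp
  -- the slice `θ = U₂(t,·)` and the slice of `F`
  set θ : E3 → ℝ := fun y => U t y 2 with hθ_def
  have hθ : ContDiff ℝ ∞ θ := contDiff_vert_slice hrate hcont hmild hdiv ht0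
  have hθd : Differentiable ℝ θ := hθ.differentiable (by simp)
  have hθ1 : ∀ w : E3, Differentiable ℝ (fun y => fderiv ℝ θ y w) := fun w =>
    ((hθ.fderiv_right (m := ∞) (by norm_cast)).clm_apply contDiff_const).differentiable (by simp)
  have hFt : (fun y : E3 => F (t, y)) = fun y => θ (y + a) - θ y := rfl
  -- translates are differentiable, with the lambda spelled out (so that `fderiv_fun_sub` matches syntactically)
  have hsa : ∀ y : E3, DifferentiableAt ℝ (fun y' : E3 => θ (y' + a)) y := fun y =>
    (hθd (y + a)).comp y (differentiableAt_id.add (differentiableAt_const a))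
  have hsa1 : ∀ (w : E3) (y : E3), DifferentiableAt ℝ (fun y' : E3 => fderiv ℝ θ (y' + a) w) y := fun w y =>
    ((hθ1 w) (y + a)).comp y (differentiableAt_id.add (differentiableAt_const a))
  -- (i) first slice derivatives of `F(t,·)`
  have hFslice : ∀ w : E3, fderiv ℝ (fun y : E3 => F (t, y)) x w = fderiv ℝ θ (x + a) w - fderiv ℝ θ x w := by
    intro w
    rw [hFt, fderiv_fun_sub (hsa x) (hθd x)]
    simp only [_root_.sub_apply]
    rw [fderiv_comp_add_right]
  -- (ii) second slice derivatives (nested) of `F(t,·)`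
  have hFnested : ∀ w : E3, fderiv ℝ (fun y : E3 => fderiv ℝ (fun y' : E3 => F (t, y')) y w) x w =
      fderiv ℝ (fun y : E3 => fderiv ℝ θ y w) (x + a) w - fderiv ℝ (fun y : E3 => fderiv ℝ θ y w) x w := by
    intro w
    have hfun : (fun y : E3 => fderiv ℝ (fun y' : E3 => F (t, y')) y w) = fun y => fderiv ℝ θ (y + a) w - fderiv ℝ θ y w := by
      funext y
      rw [hFt, fderiv_fun_sub (hsa y) (hθd y)]
      simp only [_root_.sub_apply]
      rw [fderiv_comp_add_right]
    rw [hfun, fderiv_fun_sub (hsa1 w x) ((hθ1 w) x)]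
    simp only [_root_.sub_apply]
    rw [fderiv_comp_add_right (f := fun y => fderiv ℝ θ y w)]
  -- (iii) joint derivatives of `F` along `(0,w)` = slice derivatives; chain rules of the shear
  have hsp : ∀ w : E3, fderiv ℝ F (t, x) ((0 : ℝ), w) = fderiv ℝ (fun y : E3 => F (t, y)) x w := fun w => (fderiv_slice_eq' hFd w).symm
  have hm' : pd dN G p = fderiv ℝ F (t, x) ((0 : ℝ), Jvec e) := pd_dN_comp_shearMap e d (F := F) (p := p) hFd hdp
  have hs' : pd (tg eS) G p = fderiv ℝ F (t, x) ((0 : ℝ), e) := pd_tgS_comp_shearMap e d (F := F) (p := p) hFd hdp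
  have hz' : pd (tg PoloidalWindowDoorLrcModEntireShearedCoordinates.eZ) G p - fderiv ℝ d (t, z) ((0 : ℝ), (1 : ℝ)) * pd dN G p
      = fderiv ℝ F (t, x) ((0 : ℝ), e2) := pd_tgZ_sub_comp_shearMap e d (F := F) (p := p) hFd hdp
  have ht' : pd (tg eT) G p - fderiv ℝ d (t, z) ((1 : ℝ), (0 : ℝ)) * pd dN G p = fderiv ℝ F (t, x) ((1 : ℝ), (0 : E3)) :=
    pd_tgT_sub_comp_shearMap e d (F := F) (p := p) hFd hdp
  /- (1) the class-level law at `(t, x)` -/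
  have hlaw := verticalDifference_law hrate hcont hmild hdiv hpol hμ3 ht0 htρ hslabU hxρ ha
  rw [hx2] at hlaw
  /- (2) convert each term -/
  -- (a) time derivative
  have h_a : deriv (fun s => U s (x + a) 2) t - deriv (fun s => U s x 2) t
      = pd (tg eT) G p - fderiv ℝ d (t, z) ((1 : ℝ), (0 : ℝ)) * pd dN G p := by
    rw [ht', fderiv_scalar_time hT hF htT x]
    show deriv (fun s => U s (x + a) 2) t - deriv (fun s => U s x 2) t = deriv (fun s => U s (x + a) 2 - U s x 2) t
    rw [deriv_fun_sub (differentiableAt_vert_time hrate hcont hmild hdiv ht0 (x + a)) (differentiableAt_vert_time hrate hcont hmild hdiv ht0 x)]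
  -- (b) convective difference
  have hinner : ∀ u v : E3, ⟪u, v⟫_ℝ = v 0 * u 0 + v 1 * u 1 + v 2 * u 2 := fun u v => by
    simp only [PiLp.inner_apply, RCLike.inner_apply, conj_trivial, Fin.sum_univ_three]
  have hJ0 : (Jvec e) 0 = -(e 1) := by simp [Jvec]
  have hJ1 : (Jvec e) 1 = e 0 := by simp [Jvec]
  have hJ2 : (Jvec e) 2 = 0 := by simp [Jvec]
  have hPD : ((fun q : ℝ × E3 => ⟪e, U q.1 (q.2 + a) - U q.1 q.2⟫_ℝ) ∘ shearMap e d) p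
      = (U t (x + a) - U t x) 0 * e 0 + (U t (x + a) - U t x) 1 * e 1 := by
    show ⟪e, U t (x + a) - U t x⟫_ℝ = _
    rw [hinner, he2]; ring
  have hQD : ((fun q : ℝ × E3 => ⟪Jvec e, U q.1 (q.2 + a) - U q.1 q.2⟫_ℝ) ∘ shearMap e d) p
      = (U t (x + a) - U t x) 1 * e 0 - (U t (x + a) - U t x) 0 * e 1 := by
    show ⟪Jvec e, U t (x + a) - U t x⟫_ℝ = _
    rw [hinner, hJ0, hJ1, hJ2]; ring
  have hG0 : G p = U t (x + a) 2 - U t x 2 := rfl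
  have hD2 : (U t (x + a) - U t x) 2 = G p := by rw [hG0]; simp
  have h_b : fderiv ℝ θ (x + a) (U t (x + a)) - fderiv ℝ θ x (U t x)
      = (U t (x + a) 0 * e 0 + U t (x + a) 1 * e 1) * pd (tg eS) G p
        + (U t (x + a) 1 * e 0 - U t (x + a) 0 * e 1) * pd dN G p
        + U t (x + a) 2 * (pd (tg PoloidalWindowDoorLrcModEntireShearedCoordinates.eZ) G p - fderiv ℝ d (t, z) ((0 : ℝ), (1 : ℝ)) * pd dN G p)
        + (((fun q : ℝ × E3 => ⟪e, U q.1 (q.2 + a) - U q.1 q.2⟫_ℝ) ∘ shearMap e d) p * fderiv ℝ θ x e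
          + ((fun q : ℝ × E3 => ⟪Jvec e, U q.1 (q.2 + a) - U q.1 q.2⟫_ℝ) ∘ shearMap e d) p * fderiv ℝ θ x (Jvec e)
          + G p * fderiv ℝ θ x e2) := by
    rw [convect_difference_split θ x (x + a) (U t x) (U t (x + a))]
    -- first part: `(Dθ(x+a) − Dθ(x))[Uᵃ] = DF_t(x)[Uᵃ]`, frame-decomposed
    have h1 : (fderiv ℝ θ (x + a) - fderiv ℝ θ x) (U t (x + a))
        = (U t (x + a) 0 * e 0 + U t (x + a) 1 * e 1) * pd (tg eS) G p
          + (U t (x + a) 1 * e 0 - U t (x + a) 0 * e 1) * pd dN G p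
          + U t (x + a) 2 * (pd (tg PoloidalWindowDoorLrcModEntireShearedCoordinates.eZ) G p - fderiv ℝ d (t, z) ((0 : ℝ), (1 : ℝ)) * pd dN G p) := by
      rw [hz', hs', hm', hsp, hsp, hsp, hFslice, hFslice, hFslice]
      set w := U t (x + a) with hw
      conv_lhs => rw [frame_decomp he2 hunit w]
      simp only [_root_.sub_apply, map_add, map_smul, smul_eq_mul]
    -- second part: `Dθ(x)[D] = P_D θ_e + Q_D θ_ν + F θ_z`
    have h2 : fderiv ℝ θ x (U t (x + a) - U t x)
        = (((fun q : ℝ × E3 => ⟪e, U q.1 (q.2 + a) - U q.1 q.2⟫_ℝ) ∘ shearMap e d) p * fderiv ℝ θ x e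
          + ((fun q : ℝ × E3 => ⟪Jvec e, U q.1 (q.2 + a) - U q.1 q.2⟫_ℝ) ∘ shearMap e d) p * fderiv ℝ θ x (Jvec e)
          + G p * fderiv ℝ θ x e2) := by
      rw [hPD, hQD, ← hD2]
      set Dx := U t (x + a) - U t x with hDx
      conv_lhs => rw [frame_decomp he2 hunit Dx]
      simp only [map_add, map_smul, smul_eq_mul]
    rw [h1, h2]
  -- (c) the horizontal Laplacian difference
  have h_c : (fderiv ℝ (fun x' => fderiv ℝ (fun y' => U t y' 2) x' (EuclideanSpace.single 0 1)) (x + a) (EuclideanSpace.single 0 1) +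
          fderiv ℝ (fun x' => fderiv ℝ (fun y' => U t y' 2) x' (EuclideanSpace.single 1 1)) (x + a) (EuclideanSpace.single 1 1))
        - (fderiv ℝ (fun x' => fderiv ℝ (fun y' => U t y' 2) x' (EuclideanSpace.single 0 1)) x (EuclideanSpace.single 0 1) +
          fderiv ℝ (fun x' => fderiv ℝ (fun y' => U t y' 2) x' (EuclideanSpace.single 1 1)) x (EuclideanSpace.single 1 1))
      = pd dN (pd dN G) p + pd (tg eS) (pd (tg eS) G) p := by
    rw [hG_def, pd_sum_scalar_comp_shearMap (F := F) hO hT hF he2 hunit hOT hD hd hOD hp]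
    rw [← ht_def, ← hx_def, hFnested, hFnested]
    show _ = fderiv ℝ (fun y => fderiv ℝ θ y (EuclideanSpace.single 0 1)) (x + a) (EuclideanSpace.single 0 1)
        - fderiv ℝ (fun y => fderiv ℝ θ y (EuclideanSpace.single 0 1)) x (EuclideanSpace.single 0 1)
        + (fderiv ℝ (fun y => fderiv ℝ θ y (EuclideanSpace.single 1 1)) (x + a) (EuclideanSpace.single 1 1)
          - fderiv ℝ (fun y => fderiv ℝ θ y (EuclideanSpace.single 1 1)) x (EuclideanSpace.single 1 1))
    ring
  -- (d) the right-hand side terms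
  have hcoord : ∀ y w, fderiv ℝ (U t) y w 2 = fderiv ℝ θ y w := fun y w => by
    have hsd : Differentiable ℝ (U t) := (hA.contDiff_slice ht0).differentiable (by simp)
    have h := ((EuclideanSpace.proj (𝕜 := ℝ) (2 : Fin 3)).hasFDerivAt.comp y (hsd y).hasFDerivAt).fderiv
    have e3 : (⇑(EuclideanSpace.proj (𝕜 := ℝ) (2 : Fin 3)) ∘ U t) = θ := by funext y'; simp [hθ_def]
    rw [e3] at h
    rw [h]; rfl
  have h_e : fderiv ℝ (U t) (x + a) (EuclideanSpace.single 2 1) 2 - fderiv ℝ (U t) x (EuclideanSpace.single 2 1) 2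
      = pd (tg PoloidalWindowDoorLrcModEntireShearedCoordinates.eZ) G p - fderiv ℝ d (t, z) ((0 : ℝ), (1 : ℝ)) * pd dN G p := by
    rw [hz', hsp, hFslice, hcoord, hcoord]; rfl
  have h_f : U t (x + a) 2 - U t x 2 = G p := hG0.symm
  /- (3) assemble -/
  rw [h_a, h_b, h_c, h_e, h_f] at hlaw
  linear_combination hlaw

end Summit.NavierStokesRegularity.NavierStokesRegularity.Theorems.PoloidalWindowDoorLrcModEntireShearedDifferenceRow

end
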